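import Summits.PneNP.PneNP.Theorems.ChebyshevTracialDesignCrossingPlaneByType
import Summits.PneNP.PneNP.Theorems.ChebyshevTracialDesignCrossingPlaneRemainder
import Summits.PneNP.PneNP.Theorems.ChebyshevTracialDesignCrossingPlaneExpTools
import HarnessLib

/-!
# Cell pnp-psdrank, route `ChebyshevTracialDesign`: THE ASYMPTOTIC FORM OF (CG_1′) IN THE CROSSING PLANE, PER NON-ALIGNED
# MATCHING — brick 126 (crux `TracialDecayExp20`, stmt-PneNP-19878)

Brick 126 (prover g25; MEMO-27 §4 (a)). Brick 125 (`crossingPlane_value_le_of_type`) bounds the tilted crossing-plane (CG_1′)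
value of a nonnegative block statistic, per matching `M` of good `H`-type, by brick 120's seven remainders at the explicit
type-discharged smoothness family plus the [TAIL] term. Here the asymptotic bookkeeping is done once and for all, for a
BALANCED block `|H| = n/2` and a NON-ALIGNED matching (`βn ≤ b_M(H) ≤ (½ − β)n` crossing edges, so `a = d = (n/2 − b)/2 ≥ βn/2`),
every balanced exact design with `2 ≤ D`, `D⁴ ≤ n`, `2D+1 ≤ T ≤ 7⌊√n⌋` (`T = Tq n`, `D = dq n` qualify):
* §1 `final_bound` (the last arithmetic), `tail_exp_eq` (`(K√(|H|D))²/|H| = K²D`).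
* §2 **`crossingPlane_value_le_exp`**: for every `β > 0`, `a′ > 0` there is `n₀` such that for `n ≥ n₀`, `0 ≤ ψ ≤ G`, `|λ|,|κ| ≤ 1`:
  `|PM|·Σ_U W(U,M)·ψ(|U∩H|)·(Σ_p u_p x_p x_{πp})² ≤ 10⁴·(1 + B_v)·G·n⁶·e^{−a′D}`. Constants: brick 124's margin `β₀/2`,
  window `K = √(a′ + log 2)` (tail `2^{D+1}e^{−K²D} = 2e^{−a′D}`); brick 118's margins with `β₁ = β₀/2`, `V₀ = β₀⁴n/128`,
  `r₀ = ⌈β₀n/4⌉`, Chernoff parameter `u = β₀ = min(β, 1/8)` (exponent `≤ −β₀n/64`), `m = n − 4(D+1) − 4`; the three smoothness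
  numbers are `≤ Ξ = q^{D−1} + 4^{D+1}e^{−β₀n/64}`, `q = 393216(D+1)/(β₀⁴n)`, with `T·q ≤ e^{−2a′}` and `(4T)^{D+1}e^{−β₀n/64}
  ≤ e^{−a′D}` once `n^{1/4} ≥ P*(β₀,a′)` (`…ExpTools.numerics`); the remainders collapse by `…CrossingPlaneRemainder.remainder_le`.
READING: per non-aligned matching, the (CG_1′) value of every `H`-symmetric tilted mask in the crossing plane is `≤ poly(n)·e^{−a′D}`
for EVERY `a′` — (O1)+(O2) of MEMO-25 §4 in final form; ASYMPTOTIC ONLY (`∃ n₀`), nothing effective. WHAT THIS FILE DOES NOT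
DO: the average over `M` (brick 127), directions outside the crossing plane ((O3)), unbalanced blocks; anything on
`TracialDecayExp20` itself, psd rank of P_PM(K_n), or P vs NP. [cite: Rothvoss2017, §2 (PDF pp. 5–6)]
[cite: RollinRoss2010, §3 Lemma 3.3; §4.1 Thm 4.2] [cite: Durrett2019, §2.7]
Stature: support/instrument (kernel lane, no defs, axioms standard). Supports stmt-PneNP-19878.
-/

set_option linter.dupNamespace false -- `Summit.PneNP.PneNP.…`: summit = sub-problem (D-0017)

noncomputable section

namespace Summit.PneNP.PneNP.Theorems.ChebyshevTracialDesignCrossingPlaneExp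

open Finset Literature.Barriers.PneNP Literature.Combinatorics.Optimization
open Literature.Combinatorics.Optimization.ShellStep
open Summit.PneNP.PneNP.Theorems.ChebyshevTracialDesignCrossingPlaneByType (crossingPlane_value_le_of_type)
open Summit.PneNP.PneNP.Theorems.ChebyshevTracialDesignCrossingPlaneRemainder (remainder_le)
open Summit.PneNP.PneNP.Theorems.ChebyshevTracialDesignCrossingPlaneExpTools

variable {n : ℕ}

/-! ### §1 The last arithmetic -/

/-- **Final arithmetic.** With `Ξ₁ ≤ e`, `C_b Ξ₁ ≤ 49ne`, `Ξ₂ ≤ e`, `C_b Ξ₂ ≤ e`, `2D+1 ≤ n`, `t ≤ n`, `1 ≤ n`, `tail ≤ 36Gn⁶e`: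
`200t²G((2D+1) + B_vC_b)(Ξ₁+Ξ₂) + tail ≤ 10⁴(1+B_v)Gn⁶e`. [cite: RollinRoss2010, §4.1 Thm 4.2] -/
theorem final_bound {tt G Bv Cb Ξ₁ Ξ₂ e nn DD tail : ℝ} (htt0 : 0 ≤ tt) (hG : 0 ≤ G) (hBv : 0 ≤ Bv) (hCb : 0 ≤ Cb)
    (hΞ₁ : 0 ≤ Ξ₁) (hΞ₂ : 0 ≤ Ξ₂) (he : 0 ≤ e) (hDD : 0 ≤ DD) (h1 : Ξ₁ ≤ e) (h2 : Cb * Ξ₁ ≤ 49 * nn * e)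
    (h3 : Ξ₂ ≤ e) (h4 : Cb * Ξ₂ ≤ e) (hD : 2 * DD + 1 ≤ nn) (htt : tt ≤ nn) (hn : 1 ≤ nn)
    (htail : tail ≤ 36 * G * nn ^ 6 * e) :
    200 * tt ^ 2 * G * ((2 * DD + 1) + Bv * Cb) * (Ξ₁ + Ξ₂) + tail ≤ 10 ^ 4 * (1 + Bv) * G * nn ^ 6 * e := by
  have k1 : (2 * DD + 1) * (Ξ₁ + Ξ₂) ≤ nn * (e + e) := mul_le_mul hD (add_le_add h1 h3) (by positivity) (by linarith)
  have k2 : Bv * Cb * (Ξ₁ + Ξ₂) ≤ Bv * (50 * nn * e) := by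
    rw [mul_assoc]
    refine mul_le_mul_of_nonneg_left ?_ hBv
    have : e ≤ nn * e := le_mul_of_one_le_left he hn
    nlinarith
  have k3 : ((2 * DD + 1) + Bv * Cb) * (Ξ₁ + Ξ₂) ≤ (2 + 50 * Bv) * nn * e := by nlinarith
  have k4 : tt ^ 2 ≤ nn ^ 2 := pow_le_pow_left₀ htt0 htt 2
  have k5 : 200 * tt ^ 2 * G * ((2 * DD + 1) + Bv * Cb) * (Ξ₁ + Ξ₂) ≤
      200 * nn ^ 2 * G * ((2 + 50 * Bv) * nn * e) := by
    have h0 : 0 ≤ ((2 * DD + 1) + Bv * Cb) * (Ξ₁ + Ξ₂) := by positivity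
    calc 200 * tt ^ 2 * G * ((2 * DD + 1) + Bv * Cb) * (Ξ₁ + Ξ₂)
        = 200 * tt ^ 2 * G * (((2 * DD + 1) + Bv * Cb) * (Ξ₁ + Ξ₂)) := by ring
      _ ≤ 200 * nn ^ 2 * G * (((2 * DD + 1) + Bv * Cb) * (Ξ₁ + Ξ₂)) := by gcongr
      _ ≤ 200 * nn ^ 2 * G * ((2 + 50 * Bv) * nn * e) := by gcongr
  have k6 : nn ^ 3 ≤ nn ^ 6 := pow_le_pow_right₀ hn (by norm_num)
  have k7 : 0 ≤ (400 + 10000 * Bv) * G * e := by positivity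
  have k8 := mul_le_mul_of_nonneg_left k6 k7
  nlinarith [k5, k8, htail, mul_nonneg (mul_nonneg hG he) (pow_nonneg (by linarith : (0:ℝ) ≤ nn) 6)]

/-- The [TAIL] exponent: `(K·√(h·D))²/h = K²·D` for `h > 0`, `D ≥ 0`. [cite: Durrett2019, §2.7] -/
theorem tail_exp_eq {K h D : ℝ} (hh : 0 < h) (hD : 0 ≤ D) : (K * Real.sqrt (h * D)) ^ 2 / h = K ^ 2 * D := by
  rw [mul_pow, Real.sq_sqrt (by positivity)]
  field_simp

/-! ### §2 The asymptotic form -/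

set_option maxHeartbeats 400000 in -- measured: passes at 200k, fails at 150k (one long bookkeeping proof)
/-- **(CG_1′) IN THE CROSSING PLANE PER NON-ALIGNED MATCHING, ASYMPTOTIC FORM (brick 126).** For every `β > 0` and `a′ > 0`
there is `n₀` such that for all `n ≥ n₀`: for every balanced exact design `(n,t,T,D,B_v,C,w)` with `2D+1 ≤ T ≤ 7⌊√n⌋`,
`2 ≤ D`, `D⁴ ≤ n`, every perfect matching `M` and BALANCED block `|H| = n/2` with `βn ≤ b_M(H) ≤ (½−β)n` mixed edges,
every `0 ≤ ψ ≤ G` on `[0,t]` and `|λ|, |κ| ≤ 1`: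
`|PM|·Σ_U W(U,M)·ψ(|U∩H|)·(Σ_p (λ([p,πp ∈ H] − [p,πp ∉ H]) + (λ+κ)) x_p x_{πp})² ≤ 10⁴·(1+B_v)·G·n⁶·e^{−a′D}`.
[cite: Rothvoss2017, §2 (PDF p. 6)] [cite: RollinRoss2010, §3 Lemma 3.3; §4.1 Thm 4.2] [cite: Durrett2019, §2.7] -/
theorem crossingPlane_value_le_exp {β a' : ℝ} (hβ : 0 < β) (ha' : 0 < a') :
    ∃ n₀ : ℕ, ∀ n : ℕ, n₀ ≤ n → ∀ {t T D : ℕ} {Bv : ℝ} {C : Finset ℕ} {w : ℕ → ℝ},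
    IsExactDesign n t T D Bv C w → 2 * D + 1 ≤ T → n ≤ 4 * t → 2 ≤ D → D ^ 4 ≤ n → T ≤ 7 * Nat.sqrt n →
    ∀ (M : PMatch n) (H : Finset (Fin n)), 2 * H.card = n →
    β * n ≤ (reps M.2.partner (vBH M.2.partner univ H ∪ vBN M.2.partner univ H)).card →
    ((reps M.2.partner (vBH M.2.partner univ H ∪ vBN M.2.partner univ H)).card : ℝ) ≤ (1 / 2 - β) * n →
    ∀ (ψ : ℤ → ℝ) {G : ℝ}, 0 ≤ G → (∀ x ∈ Icc (0 : ℤ) ((t : ℕ) : ℤ), |ψ x| ≤ G) →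
    (∀ x ∈ Icc (0 : ℤ) ((t : ℕ) : ℤ), 0 ≤ ψ x) → ∀ (lam kap : ℝ), |lam| ≤ 1 → |kap| ≤ 1 →
    (Fintype.card (PMatch n) : ℝ) * ∑ U : OddSet n, levelWeight n t C w U M *
        (ψ ((U.1 ∩ H).card : ℤ) *
          (∑ p : Fin n, (lam * ((if (p ∈ H ∧ M.2.partner p ∈ H) then (1 : ℝ) else 0) -
              (if (p ∉ H ∧ M.2.partner p ∉ H) then (1 : ℝ) else 0)) + (lam + kap)) *
            ((if p ∈ U.1 then (1 : ℝ) else 0) * (if M.2.partner p ∈ U.1 then (1 : ℝ) else 0))) ^ 2) ≤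
      10 ^ 4 * (1 + Bv) * G * (n : ℝ) ^ 6 * Real.exp (-(a' * D)) := by
  -- constants
  obtain ⟨β₀, hβ₀def⟩ : ∃ e : ℝ, e = min β (1 / 8) := ⟨_, rfl⟩
  have hβ₀pos : 0 < β₀ := by rw [hβ₀def]; exact lt_min hβ (by norm_num)
  have hβ₀8 : β₀ ≤ 1 / 8 := by rw [hβ₀def]; exact min_le_right _ _
  have hβ₀β : β₀ ≤ β := by rw [hβ₀def]; exact min_le_left _ _
  have hlog2 : 0 < Real.log 2 := Real.log_pos (by norm_num)
  obtain ⟨K, hKdef⟩ : ∃ K : ℝ, K = Real.sqrt (a' + Real.log 2) := ⟨_, rfl⟩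
  have hK0 : 0 ≤ K := by rw [hKdef]; exact Real.sqrt_nonneg _
  have hK2 : K ^ 2 = a' + Real.log 2 := by rw [hKdef]; exact Real.sq_sqrt (by linarith)
  obtain ⟨n₁, h125⟩ := crossingPlane_value_le_of_type (β := β₀ / 2) (K := K) (by positivity) hK0
  obtain ⟨Pstar, hPstar1, hnum⟩ := numerics hβ₀pos hβ₀8 ha'
  refine ⟨max n₁ ⌈Pstar ^ 4⌉₊, ?_⟩
  intro n hn t T D Bv C w hdes hDT hbal hD2 hD4 hT7 M H hH hblo hbhi ψ G hG0 hG hψ0 lam kap hlam hkap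
  have hn₁ : n₁ ≤ n := le_trans (le_max_left _ _) hn
  have hnP : Pstar ^ 4 ≤ (n : ℝ) :=
    le_trans (Nat.le_ceil _) (by exact_mod_cast le_trans (le_max_right _ _) hn)
  -- the quarter scale and the numerics
  have hPs4 : (1 : ℝ) ≤ Pstar ^ 4 := one_le_pow₀ hPstar1
  have hn1 : (1 : ℝ) ≤ n := hPs4.trans hnP
  obtain ⟨hP1, hP4, hsqrt, hDle⟩ := quarter_facts hn1
  have hPstar : Pstar ≤ (n : ℝ) ^ ((4 : ℕ) : ℝ)⁻¹ :=
    le_of_pow_le_pow_left₀ (by norm_num) (by linarith)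
      (show Pstar ^ 4 ≤ ((n : ℝ) ^ ((4 : ℕ) : ℝ)⁻¹) ^ 4 by rw [hP4]; exact hnP)
  have hDr2 : (2 : ℝ) ≤ D := by exact_mod_cast hD2
  have hDr1 : (1 : ℝ) ≤ D := by linarith
  have hD0 : (0 : ℝ) ≤ D := by linarith
  have hDP : (D : ℝ) ≤ (n : ℝ) ^ ((4 : ℕ) : ℝ)⁻¹ := hDle D hD0 (by exact_mod_cast hD4)
  have hT0 : (0 : ℝ) ≤ T := Nat.cast_nonneg _
  have hTP : (T : ℝ) ≤ 7 * ((n : ℝ) ^ ((4 : ℕ) : ℝ)⁻¹) ^ 2 := by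
    rw [← hsqrt]
    have h1 : ((Nat.sqrt n : ℕ) : ℝ) ≤ Real.sqrt n := Real.nat_sqrt_le_real_sqrt
    have h2 : (T : ℝ) ≤ 7 * (Nat.sqrt n : ℕ) := by exact_mod_cast hT7
    linarith
  obtain ⟨c1, c2, c3, c4, c5, c6, c7, c8, c9⟩ := hnum _ hPstar D T hDr1 hDP hT0 hTP
  rw [hP4] at c1 c2 c3 c4 c5 c6 c7 c8 c9
  have h8 : β₀ * n ≤ 1 / 8 * n := mul_le_mul_of_nonneg_right hβ₀8 (Nat.cast_nonneg (α := ℝ) n)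
  -- the type of `M` (no `set` abbreviation for the partner map: MEMO-27 §2)
  have hπ : ∀ v, M.2.partner (M.2.partner v) = v := partner_partner M
  have hπ' : ∀ v, M.2.partner v ≠ v := partner_ne M
  have hst : ∀ v ∈ (univ : Finset (Fin n)), M.2.partner v ∈ univ := fun v _ => mem_univ _
  obtain ⟨a, ha⟩ : ∃ a : ℕ, (reps M.2.partner (vAA M.2.partner univ H)).card = a := ⟨_, rfl⟩
  obtain ⟨b, hb⟩ : ∃ b : ℕ, (reps M.2.partner (vBH M.2.partner univ H ∪ vBN M.2.partner univ H)).card = b := ⟨_, rfl⟩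
  obtain ⟨d, hd⟩ : ∃ d : ℕ, (reps M.2.partner (vDD M.2.partner univ H)).card = d := ⟨_, rfl⟩
  obtain ⟨N, hN⟩ : ∃ N : ℕ, a + b + d = N := ⟨_, rfl⟩
  have hn2 : n = 2 * N := by
    have h := two_mul_typeReps_eq_card hπ hπ' hst H
    rw [ha, hb, hd, card_univ, Fintype.card_fin] at h; omega
  have hHab : H.card = 2 * a + b := by
    have := card_eq_two_mul_add_of_types hπ hπ' H; rw [ha, hb] at this; exact this
  have had : d = a := by omega
  rw [hb] at hblo hbhi
  have har : (a : ℝ) = ((n : ℝ) / 2 - b) / 2 := by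
    have : ((2 * (2 * a + b) : ℕ) : ℝ) = n := by exact_mod_cast (show 2 * (2 * a + b) = n by omega)
    push_cast at this; linarith only [this]
  have hbN : (b : ℝ) ≤ (n : ℝ) / 2 := by
    have : ((2 * b : ℕ) : ℝ) ≤ n := by exact_mod_cast (show 2 * b ≤ n by omega)
    push_cast at this; linarith only [this]
  have hb0 : (0 : ℝ) ≤ b := Nat.cast_nonneg _
  have hac : ((reps M.2.partner (vAA M.2.partner univ H)).card : ℝ) = a := by exact_mod_cast ha
  have hbc : ((reps M.2.partner (vBH M.2.partner univ H ∪ vBN M.2.partner univ H)).card : ℝ) = b := by exact_mod_cast hb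
  have hdc : ((reps M.2.partner (vDD M.2.partner univ H)).card : ℝ) = a := by
    have : ((reps M.2.partner (vDD M.2.partner univ H)).card : ℝ) = d := by exact_mod_cast hd
    rw [this]; exact_mod_cast had
  -- `b ≥ β₀ n`, `a = d ≥ β₀ n/2`
  have hβn : 0 ≤ β₀ * n := by positivity
  have hbβ₀ : β₀ * n ≤ b := le_trans (mul_le_mul_of_nonneg_right hβ₀β (Nat.cast_nonneg _)) hblo
  have haβ₀ : β₀ * n / 2 ≤ a := by
    have : (b : ℝ) ≤ (1 / 2 - β₀) * n := hbhi.trans (mul_le_mul_of_nonneg_right (by linarith only [hβ₀β]) (Nat.cast_nonneg _))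
    rw [har]; linarith only [this]
  -- `B_v ≥ 0`, `t` facts
  have hBv : 0 ≤ Bv := le_trans (sum_nonneg fun c _ => abs_nonneg _) hdes.2.2.2.2.2.2
  have htn : 2 * t + 2 ≤ n := hdes.2.1
  have hTt : T ≤ t := hdes.2.2.1
  have htD : 2 * (D + 1) + 2 ≤ t := by
    have : ((2 * (D + 1) + 2 : ℕ) : ℝ) ≤ t := by
      have hb' : (n : ℝ) ≤ 4 * t := by exact_mod_cast hbal
      push_cast; linarith only [hb', c1, h8]
    exact_mod_cast this
  obtain ⟨t₁, rfl⟩ : ∃ t₁, t = t₁ + 2 * (D + 1) + 2 := ⟨t - (2 * (D + 1) + 2), by omega⟩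
  have httr : (((t₁ + 2 * (D + 1) + 2 : ℕ) : ℝ)) ≤ n := by
    exact_mod_cast (show t₁ + 2 * (D + 1) + 2 ≤ n by omega)
  have httlo : (n : ℝ) / 2 / 2 ≤ ((t₁ + 2 * (D + 1) + 2 : ℕ) : ℝ) := by
    have : (n : ℝ) ≤ 4 * ((t₁ + 2 * (D + 1) + 2 : ℕ) : ℝ) := by exact_mod_cast hbal
    linarith only [this]
  have httN : (((t₁ + 2 * (D + 1) + 2 : ℕ) : ℝ)) ≤ (n : ℝ) / 2 - 1 := by
    have : ((2 * (t₁ + 2 * (D + 1) + 2) + 2 : ℕ) : ℝ) ≤ n := by exact_mod_cast htn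
    push_cast at this ⊢; linarith only [this]
  -- the parameters of brick 125
  obtain ⟨V₀, hV₀def⟩ : ∃ e : ℝ, e = β₀ ^ 4 * n / 128 := ⟨_, rfl⟩
  have hV₀pos : 0 < V₀ := by rw [hV₀def]; positivity
  obtain ⟨r₀, hr₀def⟩ : ∃ r : ℕ, r = ⌈β₀ * (n : ℝ) / 4⌉₊ := ⟨_, rfl⟩
  have hr₀ge : β₀ * (n : ℝ) / 4 ≤ r₀ := by rw [hr₀def]; exact Nat.le_ceil _
  have hr₀lt : (r₀ : ℝ) < β₀ * ((n : ℝ) / 2) / 2 + 1 := by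
    rw [hr₀def]
    have := Nat.ceil_lt_add_one (show 0 ≤ β₀ * (n : ℝ) / 4 by positivity)
    linarith only [this]
  have hm3 : 3 ≤ n - 4 * (D + 1) - 4 := by
    have : 4 * D + 11 ≤ n := by exact_mod_cast (show ((4 * D + 11 : ℕ) : ℝ) ≤ n by push_cast; exact c9)
    omega
  have hmn : n - 4 * (D + 1) - 4 + 4 * (D + 1) + 4 ≤ n := by omega
  -- the margins of brick 124 (`β₀/2`)
  have hm1 : β₀ / 2 * n / 2 + 2 * D + 1 ≤ ((reps M.2.partner (vAA M.2.partner univ H)).card : ℝ) := by linarith only [hac, haβ₀, c1]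
  have hm2 : β₀ / 2 * n / 2 + 2 * D + 1 ≤ ((reps M.2.partner (vBH M.2.partner univ H ∪ vBN M.2.partner univ H)).card : ℝ) := by
    linarith only [hbc, hbβ₀, c1, hβn]
  have hm3' : β₀ / 2 * n / 2 + 2 * D + 1 ≤ ((reps M.2.partner (vDD M.2.partner univ H)).card : ℝ) := by linarith only [hdc, haβ₀, c1]
  -- the margins of brick 118 (`β₁ = β₀/2`)
  have hSlo : (n : ℝ) / 4 + β₀ * n / 2 ≤
      ((reps M.2.partner (vBH M.2.partner univ H ∪ vBN M.2.partner univ H)).card : ℝ) +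
        (reps M.2.partner (vDD M.2.partner univ H)).card := by
    rw [hbc, hdc, har]; linarith only [hbβ₀]
  have hShi : ((reps M.2.partner (vBH M.2.partner univ H ∪ vBN M.2.partner univ H)).card : ℝ) +
      (reps M.2.partner (vDD M.2.partner univ H)).card ≤ (n : ℝ) / 2 := by
    rw [hbc, hdc, har]; linarith only [hbN]
  have hβS : β₀ / 2 * (((reps M.2.partner (vBH M.2.partner univ H ∪ vBN M.2.partner univ H)).card : ℝ) +
      (reps M.2.partner (vDD M.2.partner univ H)).card) ≤ β₀ / 2 * ((n : ℝ) / 2) :=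
    mul_le_mul_of_nonneg_left hShi (by positivity)
  have hbT : β₀ / 2 * (((reps M.2.partner (vBH M.2.partner univ H ∪ vBN M.2.partner univ H)).card : ℝ) +
      (reps M.2.partner (vDD M.2.partner univ H)).card) + T + 2 * (D + 2) ≤
      (reps M.2.partner (vBH M.2.partner univ H ∪ vBN M.2.partner univ H)).card := by
    linarith only [hβS, hbc, hbβ₀, c2]
  have hdT : β₀ / 2 * (((reps M.2.partner (vBH M.2.partner univ H ∪ vBN M.2.partner univ H)).card : ℝ) +
      (reps M.2.partner (vDD M.2.partner univ H)).card) + T + 2 * (D + 2) ≤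
      (reps M.2.partner (vDD M.2.partner univ H)).card := by
    linarith only [hβS, hdc, haβ₀, c2]
  have hr₀' : β₀ / 2 * (((reps M.2.partner (vBH M.2.partner univ H ∪ vBN M.2.partner univ H)).card : ℝ) +
      (reps M.2.partner (vDD M.2.partner univ H)).card) ≤ r₀ := by linarith only [hβS, hr₀ge]
  have hsT : ((t₁ + 2 * (D + 1) + 2 : ℕ) : ℝ) / 2 +
      β₀ / 2 * (((reps M.2.partner (vBH M.2.partner univ H ∪ vBN M.2.partner univ H)).card : ℝ) +
        (reps M.2.partner (vDD M.2.partner univ H)).card) + 2 * T + 4 * (D + 2) + 2 ≤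
      ((reps M.2.partner (vBH M.2.partner univ H ∪ vBN M.2.partner univ H)).card : ℝ) +
        (reps M.2.partner (vDD M.2.partner univ H)).card := by
    linarith only [hβS, hSlo, httN, c2]
  have hV₀le : V₀ ≤ (β₀ / 2) ^ 4 * ((((reps M.2.partner (vBH M.2.partner univ H ∪ vBN M.2.partner univ H)).card : ℝ) +
      (reps M.2.partner (vDD M.2.partner univ H)).card) - 4 * (D + 2) - 2 * T) := by
    rw [hV₀def]
    have hle : (n : ℝ) / 8 ≤ (((reps M.2.partner (vBH M.2.partner univ H ∪ vBN M.2.partner univ H)).card : ℝ) +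
        (reps M.2.partner (vDD M.2.partner univ H)).card) - 4 * (D + 2) - 2 * T := by
      linarith only [hSlo, c2, h8, hβn]
    calc β₀ ^ 4 * n / 128 = β₀ ^ 4 / 16 * ((n : ℝ) / 8) := by ring
      _ ≤ β₀ ^ 4 / 16 * ((((reps M.2.partner (vBH M.2.partner univ H ∪ vBN M.2.partner univ H)).card : ℝ) +
          (reps M.2.partner (vDD M.2.partner univ H)).card) - 4 * (D + 2) - 2 * T) :=
          mul_le_mul_of_nonneg_left hle (by positivity)
      _ = _ := by ring
  have hkV : (2 * (D + 1 : ℕ) : ℝ) - 1 ≤ 2 * V₀ := by rw [hV₀def]; push_cast; linarith only [c3]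
  have hNT : (T : ℝ) + 2 < (n : ℝ) / 2 := by linarith only [c4, hn1]
  -- `Ξ` and the dominating family `X`
  obtain ⟨qq, hqqdef⟩ : ∃ e : ℝ, e = 393216 * ((D : ℝ) + 1) / (β₀ ^ 4 * n) := ⟨_, rfl⟩
  have hqq0 : 0 ≤ qq := by rw [hqqdef]; positivity
  have hqqV : 3072 * ((D : ℝ) + 1) / V₀ = qq := by rw [hqqdef, hV₀def]; field_simp; ring
  have hε1 : Real.exp (-(2 * a')) ≤ 1 := by rw [Real.exp_le_one_iff]; linarith only [ha']
  have hqq1 : qq ≤ 1 := by rw [hqqdef]; exact c6.trans hε1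
  obtain ⟨τ₀, hτ₀def⟩ : ∃ e : ℝ, e = Real.exp (-(β₀ * ((n : ℝ) / 2) / 32)) := ⟨_, rfl⟩
  have hτ₀pos : 0 < τ₀ := by rw [hτ₀def]; exact Real.exp_pos _
  obtain ⟨Ξ, hΞdef⟩ : ∃ e : ℝ, e = qq ^ (D - 1) + (4 : ℝ) ^ (D + 1) * τ₀ := ⟨_, rfl⟩
  have hΞ0 : 0 ≤ Ξ := by rw [hΞdef]; positivity
  -- the Chernoff exponent
  have hE : (β₀ + β₀ ^ 2) * (((t₁ + 2 * (D + 1) + 2 : ℕ) : ℝ) / 2 *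
      (reps M.2.partner (vAA M.2.partner univ H)).card / ((n : ℝ) / 2 - T - 2)) -
      β₀ * ((((t₁ + 2 * (D + 1) + 2 : ℕ) : ℝ) - T - 2) / 2 + 1 - r₀) ≤ -(β₀ * ((n : ℝ) / 2) / 32) := by
    refine chernoff_exponent_le hβ₀pos hβ₀8 ?_ hT0 ?_ ?_ httlo hr₀lt
    · rw [hac, har]; linarith only [hbβ₀]
    · linarith only [c2, hD0, hβn]
    · linarith only [c4]
  -- domination of the explicit family on `D−1 ≤ k ≤ D+1`
  have hdom : ∀ k : ℕ, D - 1 ≤ k → k ≤ D + 1 →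
      (2 * Real.sqrt 192 * Real.sqrt (4 * k / V₀)) ^ (2 * k) +
        (4 : ℝ) ^ k * Real.exp ((β₀ + β₀ ^ 2) * (((t₁ + 2 * (D + 1) + 2 : ℕ) : ℝ) / 2 *
          (reps M.2.partner (vAA M.2.partner univ H)).card / ((n : ℝ) / 2 - T - 2)) -
          β₀ * ((((t₁ + 2 * (D + 1) + 2 : ℕ) : ℝ) - T - 2) / 2 + 1 - r₀)) ≤ Ξ := by
    intro k hk1 hk2
    rw [hΞdef]
    refine add_le_add ?_ ?_
    · have hx0 : 0 ≤ 4 * (k : ℝ) / V₀ := by positivity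
      have e1 : (2 * Real.sqrt 192 * Real.sqrt (4 * k / V₀)) ^ (2 * k) = (3072 * k / V₀) ^ k := by
        have h192 : Real.sqrt 192 ^ 2 = 192 := Real.sq_sqrt (by norm_num)
        have hxx : Real.sqrt (4 * k / V₀) ^ 2 = 4 * k / V₀ := Real.sq_sqrt hx0
        have hsq : (2 * Real.sqrt 192 * Real.sqrt (4 * k / V₀)) ^ 2 = 3072 * k / V₀ := by
          rw [mul_pow, mul_pow, h192, hxx]; ring
        rw [pow_mul, hsq]
      rw [e1]
      have hkq : 3072 * (k : ℝ) / V₀ ≤ qq := by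
        rw [← hqqV]
        refine div_le_div_of_nonneg_right ?_ hV₀pos.le
        have : (k : ℝ) ≤ (D + 1 : ℕ) := by exact_mod_cast hk2
        push_cast at this; linarith only [this]
      calc (3072 * (k : ℝ) / V₀) ^ k ≤ qq ^ k := pow_le_pow_left₀ (by positivity) hkq k
        _ ≤ qq ^ (D - 1) := pow_le_pow_of_le_one hqq0 hqq1 hk1
    · refine mul_le_mul (pow_le_pow_right₀ (by norm_num) hk2) ?_ (Real.exp_pos _).le (by positivity)
      rw [hτ₀def]; exact Real.exp_le_exp.2 hE
  obtain ⟨X, hX⟩ : ∃ X : ℕ → ℝ, ∀ k, X k = max Ξ ((2 * Real.sqrt 192 * Real.sqrt (4 * k / V₀)) ^ (2 * k) +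
      (4 : ℝ) ^ k * Real.exp ((β₀ + β₀ ^ 2) * (((t₁ + 2 * (D + 1) + 2 : ℕ) : ℝ) / 2 *
        (reps M.2.partner (vAA M.2.partner univ H)).card / ((n : ℝ) / 2 - T - 2)) -
        β₀ * ((((t₁ + 2 * (D + 1) + 2 : ℕ) : ℝ) - T - 2) / 2 + 1 - r₀))) := ⟨_, fun k => rfl⟩
  -- apply brick 125
  have h := h125 n hn₁ hdes hDT hbal (by omega) hD4 M H hm1 hm2 hm3' ψ hG0 hG lam kap hlam hkap hm3 hmn
    (β₁ := β₀ / 2) (V₀ := V₀) (u := β₀) (r₀ := r₀) (by positivity) hV₀pos hβ₀pos.le (by linarith only [hβ₀8])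
    hkV hbT hdT hr₀' hsT hV₀le hNT X (fun k => by rw [hX]; exact le_max_right _ _) hψ0
  have eU : X (D + 1) = Ξ := by rw [hX]; exact max_eq_left (hdom (D + 1) (by omega) le_rfl)
  have eM : X D = Ξ := by rw [hX]; exact max_eq_left (hdom D (by omega) (by omega))
  have eL : X (D - 1) = Ξ := by rw [hX]; exact max_eq_left (hdom (D - 1) le_rfl (by omega))
  rw [eU, eM, eL] at h
  -- collapse the seven remainders
  have hm3r : (3 : ℝ) ≤ ((n - 4 * (D + 1) - 4 : ℕ) : ℝ) := by exact_mod_cast hm3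
  have hρ0 : (0 : ℝ) ≤ ((n - 4 * (D + 1) - 4 : ℕ) : ℝ) / (4 * (((n - 4 * (D + 1) - 4 : ℕ) : ℝ) - 2)) := by
    have : (0 : ℝ) < 4 * (((n - 4 * (D + 1) - 4 : ℕ) : ℝ) - 2) := by linarith only [hm3r]
    positivity
  have hρ1 : ((n - 4 * (D + 1) - 4 : ℕ) : ℝ) / (4 * (((n - 4 * (D + 1) - 4 : ℕ) : ℝ) - 2)) ≤ 1 := by
    rw [div_le_one (by linarith only [hm3r])]; linarith only [hm3r]
  have hHn : (H.card : ℝ) / n ≤ 1 := by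
    rw [div_le_one (by linarith only [hn1])]
    exact_mod_cast (show H.card ≤ n by omega)
  have hHr : (H.card : ℝ) = (n : ℝ) / 2 := by
    have : ((2 * H.card : ℕ) : ℝ) = n := by exact_mod_cast hH
    push_cast at this; linarith only [this]
  have hn4 : (4 : ℝ) ≤ n := by linarith only [c9, hD0]
  have hnn2 : (0 : ℝ) < (n : ℝ) * ((n : ℝ) - 2) := by nlinarith only [hn4]
  have hH2 : (H.card : ℝ) ^ 2 / ((n : ℝ) * ((n : ℝ) - 2)) ≤ 1 := by
    rw [div_le_one hnn2, hHr]; nlinarith only [hn4]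
  have hH20 : 0 ≤ (H.card : ℝ) ^ 2 / ((n : ℝ) * ((n : ℝ) - 2)) := div_nonneg (sq_nonneg _) hnn2.le
  have hTt' : (T : ℝ) ≤ ((t₁ + 2 * (D + 1) + 2 : ℕ) : ℝ) := by exact_mod_cast hTt
  have hDt : 2 * (D : ℝ) + 2 ≤ ((t₁ + 2 * (D + 1) + 2 : ℕ) : ℝ) := by push_cast; linarith only [hD0]
  have hR := remainder_le (Bv := Bv) (Cb := ((((T - 1) / 2).choose (D + 1) : ℕ) : ℝ))
    (tt := ((t₁ + 2 * (D + 1) + 2 : ℕ) : ℝ)) (G := G)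
    (r₁ := (((n - 4 * (D + 1) - 4 : ℕ) : ℝ) / (4 * (((n - 4 * (D + 1) - 4 : ℕ) : ℝ) - 2))) ^ (D + 1))
    (r₂ := (((n - 4 * (D + 1) - 4 : ℕ) : ℝ) / (4 * (((n - 4 * (D + 1) - 4 : ℕ) : ℝ) - 2))) ^ D)
    (r₃ := (((n - 4 * (D + 1) - 4 : ℕ) : ℝ) / (4 * (((n - 4 * (D + 1) - 4 : ℕ) : ℝ) - 2))) ^ (D - 1))
    (Ξ := Ξ) (cD := (((2 * D).choose D : ℕ) : ℝ) / (4 : ℝ) ^ D) (DD := (D : ℝ)) (TT := (T : ℝ))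
    (h := (H.card : ℝ) / n) (h₂ := (H.card : ℝ) ^ 2 / ((n : ℝ) * ((n : ℝ) - 2)))
    hBv (Nat.cast_nonneg _) hG0 (pow_nonneg hρ0 _) (pow_nonneg hρ0 _) (pow_nonneg hρ0 _) hΞ0 hD0 hT0
    (div_nonneg (Nat.cast_nonneg _) (Nat.cast_nonneg _)) hH20 (pow_le_one₀ hρ0 hρ1) (pow_le_one₀ hρ0 hρ1) (pow_le_one₀ hρ0 hρ1)
    (centralBinom_div_four_pow_le_one' D) hHn hH2 hTt' hDt
  -- the tail
  have hHpos : (0 : ℝ) < H.card := by rw [hHr]; linarith only [hn1]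
  have htail : (2 : ℝ) ^ (D + 1) * (9 * ((t₁ + 2 * (D + 1) + 2 : ℕ) : ℝ) ^ 2 * G) *
      (((D : ℝ) + 1) * (2 * ((n : ℝ) / 2 + 1) ^ 3 * Real.exp (-((K * Real.sqrt (H.card * D)) ^ 2 / H.card)))) ≤
      36 * G * (n : ℝ) ^ 6 * Real.exp (-(a' * D)) := by
    rw [tail_exp_eq hHpos hD0, hK2]
    have e2 : (2 : ℝ) ^ (D + 1) * Real.exp (-((a' + Real.log 2) * D)) = 2 * Real.exp (-(a' * D)) := by
      have h2D : (2 : ℝ) ^ D = Real.exp (((D : ℕ) : ℝ) * Real.log 2) := by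
        rw [Real.exp_nat_mul, Real.exp_log (by norm_num)]
      rw [pow_succ, h2D, show -((a' + Real.log 2) * D) = -(a' * D) + -(((D : ℕ) : ℝ) * Real.log 2) by ring,
        Real.exp_add, Real.exp_neg (((D : ℕ) : ℝ) * Real.log 2)]
      have : Real.exp (((D : ℕ) : ℝ) * Real.log 2) ≠ 0 := (Real.exp_pos _).ne'
      field_simp
    have hD1n : (D : ℝ) + 1 ≤ n := by linarith only [c9]
    have hn2' : (n : ℝ) / 2 + 1 ≤ n := by linarith only [hn4]
    have hn20 : (0 : ℝ) ≤ (n : ℝ) / 2 + 1 := by linarith only [hn1]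
    calc (2 : ℝ) ^ (D + 1) * (9 * ((t₁ + 2 * (D + 1) + 2 : ℕ) : ℝ) ^ 2 * G) *
          (((D : ℝ) + 1) * (2 * ((n : ℝ) / 2 + 1) ^ 3 * Real.exp (-((a' + Real.log 2) * D))))
        = 9 * ((t₁ + 2 * (D + 1) + 2 : ℕ) : ℝ) ^ 2 * G * (((D : ℝ) + 1) * (2 * ((n : ℝ) / 2 + 1) ^ 3)) *
            ((2 : ℝ) ^ (D + 1) * Real.exp (-((a' + Real.log 2) * D))) := by ring
      _ = 9 * ((t₁ + 2 * (D + 1) + 2 : ℕ) : ℝ) ^ 2 * G * (((D : ℝ) + 1) * (2 * ((n : ℝ) / 2 + 1) ^ 3)) *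
            (2 * Real.exp (-(a' * D))) := by rw [e2]
      _ ≤ 9 * (n : ℝ) ^ 2 * G * ((n : ℝ) * (2 * (n : ℝ) ^ 3)) * (2 * Real.exp (-(a' * D))) := by gcongr
      _ = 36 * G * (n : ℝ) ^ 6 * Real.exp (-(a' * D)) := by ring
  -- the four exponential comparisons
  have hTqq : (T : ℝ) * qq ≤ Real.exp (-(2 * a')) := by
    rw [hqqdef]; exact le_trans (mul_le_mul_of_nonneg_right hTP (by positivity)) c5
  have hCb : ((((T - 1) / 2).choose (D + 1) : ℕ) : ℝ) ≤ (T : ℝ) ^ (D + 1) := by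
    have h1 : ((T - 1) / 2).choose (D + 1) ≤ ((T - 1) / 2) ^ (D + 1) := Nat.choose_le_pow _ _
    have h2 : ((T - 1) / 2) ^ (D + 1) ≤ T ^ (D + 1) := Nat.pow_le_pow_left (by omega) _
    exact_mod_cast h1.trans h2
  have hm1' : qq ^ (D - 1) ≤ Real.exp (-(a' * D)) := pow_pred_le_exp hqq0 (hqqdef ▸ c6) ha'.le hD2
  have hm2' : ((((T - 1) / 2).choose (D + 1) : ℕ) : ℝ) * qq ^ (D - 1) ≤ 49 * n * Real.exp (-(a' * D)) := by
    have hsplit : (T : ℝ) ^ (D + 1) * qq ^ (D - 1) = (T : ℝ) ^ 2 * ((T : ℝ) * qq) ^ (D - 1) := by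
      rw [mul_pow, show (T : ℝ) ^ (D + 1) = (T : ℝ) ^ 2 * (T : ℝ) ^ (D - 1) by
        rw [← pow_add]; congr 1; omega]
      ring
    have hT2 : (T : ℝ) ^ 2 ≤ 49 * n := by
      have : (T : ℝ) ^ 2 ≤ (7 * ((n : ℝ) ^ ((4 : ℕ) : ℝ)⁻¹) ^ 2) ^ 2 := pow_le_pow_left₀ hT0 hTP 2
      rw [← hP4]; nlinarith only [this]
    calc ((((T - 1) / 2).choose (D + 1) : ℕ) : ℝ) * qq ^ (D - 1) ≤ (T : ℝ) ^ (D + 1) * qq ^ (D - 1) :=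
          mul_le_mul_of_nonneg_right hCb (by positivity)
      _ = (T : ℝ) ^ 2 * ((T : ℝ) * qq) ^ (D - 1) := hsplit
      _ ≤ 49 * n * Real.exp (-(a' * D)) :=
          mul_le_mul hT2 (pow_pred_le_exp (by positivity) hTqq ha'.le hD2) (by positivity) (by positivity)
  have hm3'' : (4 : ℝ) ^ (D + 1) * τ₀ ≤ Real.exp (-(a' * D)) := by rw [hτ₀def]; exact four_pow_mul_exp_le (by linarith only [c7])
  have hTpos : (0 : ℝ) < T := by
    have : ((2 * D + 1 : ℕ) : ℝ) ≤ T := by exact_mod_cast hDT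
    push_cast at this; linarith only [this, hD0]
  have hm4' : ((((T - 1) / 2).choose (D + 1) : ℕ) : ℝ) * ((4 : ℝ) ^ (D + 1) * τ₀) ≤ Real.exp (-(a' * D)) := by
    have hc8 : ((D : ℝ) + 1) * (4 * T) + a' * D ≤ β₀ * ((n : ℝ) / 2) / 32 := by
      have : ((D : ℝ) + 1) * (4 * T) ≤ ((D : ℝ) + 1) * (4 * (7 * ((n : ℝ) ^ ((4 : ℕ) : ℝ)⁻¹) ^ 2)) :=
        mul_le_mul_of_nonneg_left (by linarith only [hTP]) (by positivity)
      linarith only [this, c8]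
    calc ((((T - 1) / 2).choose (D + 1) : ℕ) : ℝ) * ((4 : ℝ) ^ (D + 1) * τ₀)
        ≤ (T : ℝ) ^ (D + 1) * ((4 : ℝ) ^ (D + 1) * τ₀) := mul_le_mul_of_nonneg_right hCb (by positivity)
      _ = (T : ℝ) ^ (D + 1) * (4 : ℝ) ^ (D + 1) * Real.exp (-(β₀ * ((n : ℝ) / 2) / 32)) := by rw [hτ₀def]; ring
      _ ≤ Real.exp (-(a' * D)) := mul_pow_four_pow_mul_exp_le hTpos hc8
  -- assemble
  refine h.trans ((add_le_add hR le_rfl).trans ?_)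
  rw [hΞdef]
  exact final_bound (Nat.cast_nonneg _) hG0 hBv (Nat.cast_nonneg _) (by positivity) (by positivity)
    (Real.exp_pos _).le hD0 hm1' hm2' hm3'' hm4' (by linarith only [c9]) httr hn1 htail

end Summit.PneNP.PneNP.Theorems.ChebyshevTracialDesignCrossingPlaneExp

end
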